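import Literature.MeasureTheory.Group.InvariantQuotientNormalized
import Literature.MeasureTheory.Group.InvariantQuotientUnfoldingBochner
import Literature.MeasureTheory.Group.BruhatFunction
import HarnessLib

/-!
# Integration in stages on coset spaces for integrable (complex) functions:
# `∫_{G ⧸ H} f dμ_{G/H} = c ∫_{G ⧸ L} (∫_{L ⧸ H⊓L} f(g ℓ H) dμ_{L/H}(ℓ)) dμ_{G/L}(gL)`

Topic `MeasureTheory/Group`; namespace `Literature.MeasureTheory.Group`. Theorems only; no named
fact, no instance. The Bochner companion of the chain rule `InvariantQuotientChainRule` /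
`InvariantQuotientNormalized` (`exists_lintegral_eq_mul_lintegral_innerLIntegral`,
`lintegral_eq_unfoldingConstant_mul_lintegral_innerLIntegral`: Borel `f ≥ 0`, `[0, ∞]`-valued), for
INTEGRABLE complex `f` and with the SAME constant `c = c₁ c₂⁻¹ c₃⁻¹` (the three unfolding constants
of `μ_{G/H}`, `μ_{G/L}`, `μ_{L/H}`). Setting: `G` locally compact second countable Hausdorff,
`H ≤ L ≤ G` closed, `μ_{G/H}`, `μ_{G/L}` `G`-invariant and `μ_{L/H}` `L`-invariant Borel measures
finite on compact sets and non-zero (Folland (1995), Thm. 2.49; Bourbaki, *Intégration* VII §2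
no. 8; Reiter–Stegeman (2000), §8.1).

Proof: the `[0, ∞]` proof verbatim with the tree's Bochner Weil formula
(`InvariantQuotientUnfoldingBochner.integral_fiberIntegralE_eq_mul_integral`, three times: for
`H ≤ G`, `L ≤ G` and `H ⊓ L ≤ L`) and the representation `f = (β · (f ∘ π))^H` of an integrable `f`
through a Bruhat function `β` of `H` (`IsBruhatFunction.integrable_mul_comp_mk`).

* `fiberIntegralE_subgroupOf_eq` — the Bochner fibre integral over `H ⊓ L ≤ L` for the transported
  Haar measure is the fibre integral over `H` (cf. `fiberLIntegral_subgroupOf_eq`).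
* `integral_smul_inclQuot_eq_of_mk_eq` — `∫_{L ⧸ H⊓L} f(g • ℓH) dμ_{L/H}` depends only on `gL`
  (so `y ↦ ∫ f(y.out • ℓH)` is "the" inner integral; no definition is introduced).
* `integral_eq_unfoldingConstant_mul_integral_integral` — **the chain rule for `f : G ⧸ H → ℂ`
  Borel and `μ_{G/H}`-integrable**: (a) for `μ_{G/L}`-a.e. `gL`, `ℓH ↦ f(g • ℓH)` is
  `μ_{L/H}`-integrable (every representative `g`); (b) `gL ↦ ∫_{L/H} f(g • ℓH)` is
  `μ_{G/L}`-integrable; (c) `∫_{G/H} f = c₁ c₂⁻¹ c₃⁻¹ ∫_{G/L} ∫_{L/H} f(g • ℓH)`.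
* `exists_lintegral_and_integral_eq_mul_innerIntegral` — ONE constant `c ∈ (0, ∞)` carrying both the
  `[0, ∞]` identity of `InvariantQuotientNormalized` and the Bochner identity (for the consumers
  that need the two together: orbital integrals of `C_c` test functions in stages,
  `GLnLeviOrbitalDescent`).

## References

* [Folland1995] G. B. Folland, *A Course in Abstract Harmonic Analysis* (1995), §2.6 Thm. 2.49.
* [GetzHahn2024] J. R. Getz, H. Hahn, *An Introduction to Automorphic Representations* (2024),
  Thm. 3.2.2.
-/

noncomputable section

open _root_.MeasureTheory _root_.MeasureTheory.Measure _root_.Topology Set Filter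
open scoped ENNReal NNReal

namespace Literature.MeasureTheory.Group

/-! ### Transport of the Bochner fibre integral to `H ⊓ L ≤ L`; the inner integral -/

section Aux

variable {G : Type*} [Group G] [TopologicalSpace G] [IsTopologicalGroup G]
  [MeasurableSpace G] [BorelSpace G] (H L : Subgroup G)
  {E : Type*} [NormedAddCommGroup E] [NormedSpace ℝ E]

/-- **The Bochner fibre integral over `H ⊓ L ≤ L`, for the Haar measure transported from `H`, is the
fibre integral over `H`**: `fiberIntegralE (H.subgroupOf L) ρ' (ℓ ↦ φ(g ℓ)) (xH) = fiberIntegralE H ρ_H φ (g x H)`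
for `ρ' = (e⁻¹)_* ρ_H`, `e : H ⊓ L ≃ H` (`integral_map_equiv`; cf. `fiberLIntegral_subgroupOf_eq`).
[cite: Folland1995, §2.6 Thm. 2.49] -/
theorem fiberIntegralE_subgroupOf_eq (hHL : H ≤ L) (ρH : Measure H) [ρH.IsMulLeftInvariant]
    (ρ' : Measure (H.subgroupOf L)) [ρ'.IsMulLeftInvariant]
    (hρ' : ρ' = Measure.map (Subgroup.subgroupOfEquivOfLe hHL).symm ρH) (φ : G → E)
    (g : G) (x : L) :
    fiberIntegralE (H.subgroupOf L) ρ' (fun ℓ : L => φ (g * ℓ)) (QuotientGroup.mk x) =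
      fiberIntegralE H ρH φ (QuotientGroup.mk (g * x)) := by
  rw [fiberIntegralE_mk, fiberIntegralE_mk, hρ', ← coe_subgroupOfMeasurableEquiv H L hHL,
    integral_map_equiv]
  refine integral_congr_ae (Eventually.of_forall fun h => ?_)
  simp [Subgroup.coe_mul, mul_assoc]

variable [MeasurableSpace (L ⧸ H.subgroupOf L)] [BorelSpace (L ⧸ H.subgroupOf L)]
  (μLH : Measure (L ⧸ H.subgroupOf L)) [SMulInvariantMeasure L (L ⧸ H.subgroupOf L) μLH]

/-- **The inner integral depends only on the coset**: if `gL = g'L` then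
`∫_{L ⧸ H⊓L} f(g • ℓH) dμ_{L/H} = ∫_{L ⧸ H⊓L} f(g' • ℓH) dμ_{L/H}` (the integrands differ by the
measure-preserving translation `z ↦ (g⁻¹g') • z` of `L ⧸ H⊓L`; cf. `innerLIntegral`). In particular
`gL ↦ ∫ f((gL).out • ℓH)` computes `∫ f(g • ℓH)` for every representative `g`. [cite: Folland1995, §2.6 Thm. 2.49] -/
theorem integral_smul_inclQuot_eq_of_mk_eq (f : G ⧸ H → E) {g g' : G}
    (h : (QuotientGroup.mk g : G ⧸ L) = QuotientGroup.mk g') :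
    ∫ z, f (g • inclQuot H L z) ∂μLH = ∫ z, f (g' • inclQuot H L z) ∂μLH := by
  have hab : g⁻¹ * g' ∈ L := by
    rw [← QuotientGroup.leftRel_apply]; exact Quotient.exact' h
  have key : ∀ z, f (g' • inclQuot H L z) = f (g • inclQuot H L ((⟨g⁻¹ * g', hab⟩ : L) • z)) :=
    fun z => by rw [← smul_inclQuot, smul_smul, Subgroup.coe_mk, mul_inv_cancel_left]
  simp_rw [key]
  exact ((measurePreserving_smul (⟨g⁻¹ * g', hab⟩ : L) μLH).integral_comp
    (measurableEmbedding_const_smul _) (fun z => f (g • inclQuot H L z))).symm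

/-- `∫ f((gL).out • ℓH) dμ_{L/H} = ∫ f(g • ℓH) dμ_{L/H}`. [cite: Folland1995, §2.6 Thm. 2.49] -/
theorem integral_out_smul_inclQuot_eq (f : G ⧸ H → E) (g : G) :
    ∫ z, f ((QuotientGroup.mk g : G ⧸ L).out • inclQuot H L z) ∂μLH =
      ∫ z, f (g • inclQuot H L z) ∂μLH :=
  integral_smul_inclQuot_eq_of_mk_eq H L μLH f (QuotientGroup.out_eq' _)

end Aux

/-! ### The chain rule for integrable complex functions -/

section ChainBochner

variable {G : Type*} [Group G] [TopologicalSpace G] [IsTopologicalGroup G] [LocallyCompactSpace G]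
  [SecondCountableTopology G] [T2Space G] [MeasurableSpace G] [BorelSpace G]
  (H L : Subgroup G) [hH : IsClosed (H : Set G)] [hL : IsClosed (L : Set G)]
  [MeasurableSpace (G ⧸ H)] [BorelSpace (G ⧸ H)] [MeasurableSpace (G ⧸ L)] [BorelSpace (G ⧸ L)]
  [MeasurableSpace (L ⧸ H.subgroupOf L)] [BorelSpace (L ⧸ H.subgroupOf L)]
  (μGH : Measure (G ⧸ H)) [SMulInvariantMeasure G (G ⧸ H) μGH] [IsFiniteMeasureOnCompacts μGH]
  (μGL : Measure (G ⧸ L)) [SMulInvariantMeasure G (G ⧸ L) μGL] [IsFiniteMeasureOnCompacts μGL]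
  (μLH : Measure (L ⧸ H.subgroupOf L)) [SMulInvariantMeasure L (L ⧸ H.subgroupOf L) μLH]
  [IsFiniteMeasureOnCompacts μLH]
  (ν : Measure G) [IsHaarMeasure ν]
  (ρL : Measure L) [IsHaarMeasure ρL] [SFinite ρL]
  (ρH : Measure H) [IsHaarMeasure ρH] [SFinite ρH]
  (ρ' : Measure (H.subgroupOf L)) [IsHaarMeasure ρ'] [SFinite ρ']

/-- **Integration in stages for integrable complex functions (the chain rule, Bochner form).** Let
`G` be locally compact second countable Hausdorff, `H ≤ L ≤ G` closed, `μ_{G/H}`, `μ_{G/L}`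
`G`-invariant and `μ_{L/H}` `L`-invariant Borel measures finite on compact sets, all non-zero; fix
Haar measures `ν`, `ρ_L`, `ρ_H` (transport `ρ'` to `H ⊓ L ≤ L`) and the three unfolding constants
`c₁ = c(μ_{G/H}; ρ_H, ν)`, `c₂ = c(μ_{G/L}; ρ_L, ν)`, `c₃ = c(μ_{L/H}; ρ', ρ_L)`. For `f : G ⧸ H → ℂ`
Borel and `μ_{G/H}`-integrable: (a) for `μ_{G/L}`-a.e. coset `gL` (every representative `g`) the
function `ℓH ↦ f(g ℓ H)` is `μ_{L/H}`-integrable; (b) `gL ↦ ∫_{L ⧸ H⊓L} f(g ℓ H) dμ_{L/H}` is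
`μ_{G/L}`-integrable; (c)
`∫_{G ⧸ H} f dμ_{G/H} = c₁ c₂⁻¹ c₃⁻¹ ∫_{G ⧸ L} (∫_{L ⧸ H⊓L} f(g ℓ H) dμ_{L/H}) dμ_{G/L}(gL)` — the
constant of `lintegral_eq_unfoldingConstant_mul_lintegral_innerLIntegral`. (Weil's formula in
Bochner form three times, `integral_fiberIntegralE_eq_mul_integral`, and `f = (β · f ∘ π)^H` for a
Bruhat function `β` of `H`.) [cite: Folland1995, §2.6 Thm. 2.49] -/
theorem integral_eq_unfoldingConstant_mul_integral_integral (hHL : H ≤ L)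
    (hρ' : ρ' = Measure.map (Subgroup.subgroupOfEquivOfLe hHL).symm ρH)
    (hGH : μGH ≠ 0) (hGL : μGL ≠ 0) (hLH : μLH ≠ 0)
    {f : G ⧸ H → ℂ} (hfm : Measurable f) (hf : Integrable f μGH) :
    (∀ᵐ y ∂μGL, ∀ g : G, (QuotientGroup.mk g : G ⧸ L) = y →
        Integrable (fun z : L ⧸ H.subgroupOf L => f (g • inclQuot H L z)) μLH) ∧
      Integrable (fun y : G ⧸ L => ∫ z, f (y.out • inclQuot H L z) ∂μLH) μGL ∧
      ∫ x, f x ∂μGH =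
        ((unfoldingConstant H ρH μGH ν * (unfoldingConstant L ρL μGL ν)⁻¹ *
          (unfoldingConstant (H.subgroupOf L) ρ' μLH ρL)⁻¹ : ℝ≥0) : ℂ) *
          ∫ y, ∫ z, f (y.out • inclQuot H L z) ∂μLH ∂μGL := by
  -- the closed subgroups as locally compact second countable groups
  haveI : LocallyCompactSpace L := hL.isClosedEmbedding_subtypeVal.locallyCompactSpace
  haveI : LocallyCompactSpace H := hH.isClosedEmbedding_subtypeVal.locallyCompactSpace
  haveI : SecondCountableTopology L := TopologicalSpace.Subtype.secondCountableTopology _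
  haveI : SecondCountableTopology H := TopologicalSpace.Subtype.secondCountableTopology _
  haveI : SecondCountableTopology (H.subgroupOf L) := TopologicalSpace.Subtype.secondCountableTopology _
  haveI : IsClosed ((H.subgroupOf L : Subgroup L) : Set L) := isClosed_subgroupOf H L hH
  haveI : LocallyCompactSpace (H.subgroupOf L) :=
    (isClosed_subgroupOf H L hH).isClosedEmbedding_subtypeVal.locallyCompactSpace
  have hρH0 : ρH ≠ 0 := fun h => by
    have h2 : 0 < ρH Set.univ := isOpen_univ.measure_pos ρH ⟨1, trivial⟩
    rw [h] at h2; exact lt_irrefl _ h2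
  have hρL0 : ρL ≠ 0 := fun h => by
    have h2 : 0 < ρL Set.univ := isOpen_univ.measure_pos ρL ⟨1, trivial⟩
    rw [h] at h2; exact lt_irrefl _ h2
  have hρ'0 : ρ' ≠ 0 := fun h => by
    have h2 : 0 < ρ' Set.univ := isOpen_univ.measure_pos ρ' ⟨1, trivial⟩
    rw [h] at h2; exact lt_irrefl _ h2
  -- the three unfolding constants (as non-negative reals)
  set c₁ : ℝ≥0 := unfoldingConstant H ρH μGH ν with hc₁
  set c₂ : ℝ≥0 := unfoldingConstant L ρL μGL ν with hc₂
  set c₃ : ℝ≥0 := unfoldingConstant (H.subgroupOf L) ρ' μLH ρL with hc₃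
  have hc1 : c₁ ≠ 0 := (unfoldingConstant_pos H ρH μGH ν hGH hρH0).ne'
  have hc2 : c₂ ≠ 0 := (unfoldingConstant_pos L ρL μGL ν hGL hρL0).ne'
  have hc3 : c₃ ≠ 0 := (unfoldingConstant_pos (H.subgroupOf L) ρ' μLH ρL hLH hρ'0).ne'
  have hmkH : Measurable (QuotientGroup.mk : G → G ⧸ H) := QuotientGroup.continuous_mk.measurable
  -- a Bruhat function of `H` and the integrable lift `φ = β · (f ∘ π)` of `f`
  obtain ⟨β, hβ⟩ : ∃ β, IsBruhatFunction H ρH β := ⟨_, isBruhatFunction_bruhatFunction H ρH hH⟩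
  set φ : G → ℂ := fun g => (β g : ℂ) * f (QuotientGroup.mk g) with hφ
  have hφm : Measurable φ :=
    (Complex.measurable_ofReal.comp hβ.continuous.measurable).mul (hfm.comp hmkH)
  have hφi : Integrable φ ν := by
    have h := hβ.integrable_mul_comp_mk H ρH μGH ν hfm.stronglyMeasurable hf hc1
    refine h.congr (Eventually.of_forall fun g => ?_)
    simp only [hφ, Complex.real_smul]
  -- `φ^H = f`
  have hβ1 : ∀ x, fiberIntegralE H ρH (fun g => (β g : ℂ)) x = 1 := by
    intro x
    induction x using QuotientGroup.induction_on with
    | H g =>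
      rw [fiberIntegralE_mk, integral_complex_ofReal, hβ.integral_fiber g, Complex.ofReal_one]
  have hfib : ∀ x, fiberIntegralE H ρH φ x = f x := by
    intro x
    rw [hφ, fiberIntegralE_mul_comp_mk H ρH (fun g => (β g : ℂ)) f x, hβ1 x, one_mul]
  -- Weil for `H ≤ G` and for `L ≤ G`
  have hWH : ∫ x, f x ∂μGH = (c₁ : ℂ) * ∫ g, φ g ∂ν := by
    rw [← integral_fiberIntegralE_eq_mul_integral H ρH μGH ν hφm hφi]
    exact integral_congr_ae (Eventually.of_forall fun x => (hfib x).symm)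
  have hWL : ∫ y, fiberIntegralE L ρL φ y ∂μGL = (c₂ : ℂ) * ∫ g, φ g ∂ν :=
    integral_fiberIntegralE_eq_mul_integral L ρL μGL ν hφm hφi
  -- fibrewise integrability over `L`, and Weil on the group `L` for `H ⊓ L`, a.e. in `gL`
  have haeL := ae_integrable_fiber_of_integrable L ρL μGL ν hφm hφi
  have hP : ∀ g : G, Integrable (fun ℓ : L => φ (g * ℓ)) ρL →
      (Integrable (fun z : L ⧸ H.subgroupOf L => f (g • inclQuot H L z)) μLH) ∧
      fiberIntegralE L ρL φ (QuotientGroup.mk g) =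
        (c₃ : ℂ)⁻¹ * ∫ z, f (g • inclQuot H L z) ∂μLH := by
    intro g hg
    have hψm : Measurable fun ℓ : L => φ (g * ℓ) :=
      hφm.comp (continuous_const.mul continuous_subtype_val).measurable
    -- the fibre integral over `H ⊓ L` of `φ(g ·)` is `f(g • ·)`
    have h4 : ∀ z, fiberIntegralE (H.subgroupOf L) ρ' (fun ℓ : L => φ (g * ℓ)) z =
        f (g • inclQuot H L z) := by
      intro z
      induction z using QuotientGroup.induction_on with
      | H x =>
        rw [fiberIntegralE_subgroupOf_eq H L hHL ρH ρ' hρ' φ g x, hfib, inclQuot_mk,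
          MulAction.Quotient.smul_mk, smul_eq_mul]
    refine ⟨?_, ?_⟩
    · have hint := integrable_fiberIntegralE_of_integrable (H.subgroupOf L) ρ' μLH ρL hψm hg
      exact hint.congr (Eventually.of_forall h4)
    · have h3 := integral_fiberIntegralE_eq_mul_integral (H.subgroupOf L) ρ' μLH ρL hψm hg
      rw [fiberIntegralE_mk]
      have h3' : ∫ z, f (g • inclQuot H L z) ∂μLH = (c₃ : ℂ) * ∫ ℓ, φ (g * ℓ) ∂ρL := by
        rw [← h3]; exact integral_congr_ae (Eventually.of_forall fun z => (h4 z).symm)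
      rw [h3', ← mul_assoc, inv_mul_cancel₀ (by exact_mod_cast hc3), one_mul]
  -- (a) fibrewise integrability
  have hA : ∀ᵐ y ∂μGL, ∀ g : G, (QuotientGroup.mk g : G ⧸ L) = y →
      Integrable (fun z : L ⧸ H.subgroupOf L => f (g • inclQuot H L z)) μLH := by
    filter_upwards [haeL] with y hy g hg
    exact (hP g (hy g hg)).1
  -- (b) the inner integral is `c₃ • (fibre integral over L of φ)` a.e., hence integrable
  have hB : (fun y : G ⧸ L => ∫ z, f (y.out • inclQuot H L z) ∂μLH) =ᵐ[μGL]
      fun y => (c₃ : ℂ) * fiberIntegralE L ρL φ y := by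
    filter_upwards [haeL] with y hy
    have hg := hy y.out y.out_eq'
    rw [show fiberIntegralE L ρL φ y = fiberIntegralE L ρL φ (QuotientGroup.mk y.out) by
      rw [QuotientGroup.out_eq'], (hP y.out hg).2, ← mul_assoc, mul_inv_cancel₀ (by exact_mod_cast hc3),
      one_mul]
  have hBint : Integrable (fun y : G ⧸ L => ∫ z, f (y.out • inclQuot H L z) ∂μLH) μGL :=
    ((integrable_fiberIntegralE_of_integrable L ρL μGL ν hφm hφi).const_mul (c₃ : ℂ)).congr hB.symm
  refine ⟨hA, hBint, ?_⟩
  -- (c) assemble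
  have hc2C : (c₂ : ℂ) ≠ 0 := by exact_mod_cast hc2
  have hc3C : (c₃ : ℂ) ≠ 0 := by exact_mod_cast hc3
  calc ∫ x, f x ∂μGH = (c₁ : ℂ) * ∫ g, φ g ∂ν := hWH
    _ = (c₁ : ℂ) * ((c₂ : ℂ)⁻¹ * ∫ y, fiberIntegralE L ρL φ y ∂μGL) := by
        rw [hWL, ← mul_assoc (c₂ : ℂ)⁻¹, inv_mul_cancel₀ hc2C, one_mul]
    _ = (c₁ : ℂ) * ((c₂ : ℂ)⁻¹ * ((c₃ : ℂ)⁻¹ *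
          ∫ y, ∫ z, f (y.out • inclQuot H L z) ∂μLH ∂μGL)) := by
        rw [integral_congr_ae hB, integral_const_mul, ← mul_assoc (c₃ : ℂ)⁻¹, inv_mul_cancel₀ hc3C,
          one_mul]
    _ = _ := by
        simp only [NNReal.coe_mul, NNReal.coe_inv, Complex.ofReal_mul, Complex.ofReal_inv, mul_assoc]

/-- **One constant for both forms of the chain rule.** There is `c ∈ (0, ∞)` (the explicit
`c₁ c₂⁻¹ c₃⁻¹` above) with `∫⁻_{G ⧸ H} u dμ_{G/H} = c ∫⁻_{G ⧸ L} innerLIntegral u dμ_{G/L}` for every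
Borel `u : G ⧸ H → [0, ∞]` AND `∫_{G ⧸ H} f dμ_{G/H} = c ∫_{G ⧸ L} ∫_{L ⧸ H⊓L} f(g ℓ H) dμ_{L/H} dμ_{G/L}`
(with the integrability conclusions of `integral_eq_unfoldingConstant_mul_integral_integral`) for
every Borel `μ_{G/H}`-integrable `f : G ⧸ H → ℂ`. [cite: Folland1995, §2.6 Thm. 2.49] -/
theorem exists_lintegral_and_integral_eq_mul_innerIntegral (hHL : H ≤ L)
    (hGH : μGH ≠ 0) (hGL : μGL ≠ 0) (hLH : μLH ≠ 0) :
    ∃ c : ℝ≥0, c ≠ 0 ∧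
      (∀ u : G ⧸ H → ℝ≥0∞, Measurable u →
        ∫⁻ x, u x ∂μGH = (c : ℝ≥0∞) * ∫⁻ y, innerLIntegral H L μLH u y ∂μGL) ∧
      ∀ f : G ⧸ H → ℂ, Measurable f → Integrable f μGH →
        (∀ᵐ y ∂μGL, ∀ g : G, (QuotientGroup.mk g : G ⧸ L) = y →
            Integrable (fun z : L ⧸ H.subgroupOf L => f (g • inclQuot H L z)) μLH) ∧
          Integrable (fun y : G ⧸ L => ∫ z, f (y.out • inclQuot H L z) ∂μLH) μGL ∧
          ∫ x, f x ∂μGH = (c : ℂ) * ∫ y, ∫ z, f (y.out • inclQuot H L z) ∂μLH ∂μGL := by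
  haveI : LocallyCompactSpace L := hL.isClosedEmbedding_subtypeVal.locallyCompactSpace
  haveI : LocallyCompactSpace H := hH.isClosedEmbedding_subtypeVal.locallyCompactSpace
  haveI : SecondCountableTopology L := TopologicalSpace.Subtype.secondCountableTopology _
  haveI : SecondCountableTopology H := TopologicalSpace.Subtype.secondCountableTopology _
  haveI : SecondCountableTopology (H.subgroupOf L) := TopologicalSpace.Subtype.secondCountableTopology _
  haveI : IsClosed ((H.subgroupOf L : Subgroup L) : Set L) := isClosed_subgroupOf H L hH
  haveI : LocallyCompactSpace (H.subgroupOf L) :=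
    (isClosed_subgroupOf H L hH).isClosedEmbedding_subtypeVal.locallyCompactSpace
  -- Haar measures and the transport to `H ⊓ L ≤ L`
  obtain ⟨νG, hνG⟩ : ∃ ν : Measure G, IsHaarMeasure ν := ⟨Measure.haar, inferInstance⟩
  obtain ⟨ρL, hρL⟩ : ∃ ρ : Measure L, IsHaarMeasure ρ := ⟨Measure.haar, inferInstance⟩
  obtain ⟨ρH, hρH⟩ : ∃ ρ : Measure H, IsHaarMeasure ρ := ⟨Measure.haar, inferInstance⟩
  obtain ⟨ρHL, hρHLh, hρHL⟩ : ∃ ρ' : Measure (H.subgroupOf L), IsHaarMeasure ρ' ∧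
      ρ' = Measure.map (Subgroup.subgroupOfEquivOfLe hHL).symm ρH :=
    ⟨_, MulEquiv.isHaarMeasure_map ρH (Subgroup.subgroupOfEquivOfLe hHL).symm
      (continuous_subgroupOfEquivOfLe_symm H L hHL) (continuous_subgroupOfEquivOfLe H L hHL), rfl⟩
  have hρH0 : ρH ≠ 0 := fun h => by
    have h2 : 0 < ρH Set.univ := isOpen_univ.measure_pos ρH ⟨1, trivial⟩
    rw [h] at h2; exact lt_irrefl _ h2
  have hρL0 : ρL ≠ 0 := fun h => by
    have h2 : 0 < ρL Set.univ := isOpen_univ.measure_pos ρL ⟨1, trivial⟩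
    rw [h] at h2; exact lt_irrefl _ h2
  have hρHL0 : ρHL ≠ 0 := fun h => by
    have h2 : 0 < ρHL Set.univ := isOpen_univ.measure_pos ρHL ⟨1, trivial⟩
    rw [h] at h2; exact lt_irrefl _ h2
  set c₁ : ℝ≥0 := unfoldingConstant H ρH μGH νG with hc₁
  set c₂ : ℝ≥0 := unfoldingConstant L ρL μGL νG with hc₂
  set c₃ : ℝ≥0 := unfoldingConstant (H.subgroupOf L) ρHL μLH ρL with hc₃
  have hc1 : c₁ ≠ 0 := (unfoldingConstant_pos H ρH μGH νG hGH hρH0).ne'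
  have hc2 : c₂ ≠ 0 := (unfoldingConstant_pos L ρL μGL νG hGL hρL0).ne'
  have hc3 : c₃ ≠ 0 := (unfoldingConstant_pos (H.subgroupOf L) ρHL μLH ρL hLH hρHL0).ne'
  refine ⟨c₁ * c₂⁻¹ * c₃⁻¹, mul_ne_zero (mul_ne_zero hc1 (inv_ne_zero hc2)) (inv_ne_zero hc3),
    fun u hu => ?_, fun f hfm hf => ?_⟩
  · rw [lintegral_eq_unfoldingConstant_mul_lintegral_innerLIntegral H L μGH μGL μLH νG ρL ρH ρHL hHL
      hρHL hGL hLH hu]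
    congr 1
    rw [ENNReal.coe_mul, ENNReal.coe_mul, ENNReal.coe_inv hc2, ENNReal.coe_inv hc3]
  · exact integral_eq_unfoldingConstant_mul_integral_integral H L μGH μGL μLH νG ρL ρH ρHL hHL hρHL
      hGH hGL hLH hfm hf

end ChainBochner

end Literature.MeasureTheory.Group
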